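import Literature.MathematicalPhysics.QuantumLattice.HubbardEffectiveActionCT
import Literature.MathematicalPhysics.QuantumLattice.GrassmannLinearSubstitution
import HarnessLib

/-!
# The exact embedding of the Hubbard torus at Matsubara cutoff `M` into the one at cutoff `M″ ≥ M`

Topic `MathematicalPhysics/QuantumLattice`; companion of `HubbardFreeCovariance.lean`,
`HubbardEffectiveAction(CT).lean` and `GrassmannLinearSubstitution.lean`.  The Grassmann representation
of the Hubbard torus keeps the `2M` fermionic Matsubara frequencies `ω_n = π(2n+1)/β`, `-M ≤ n < M`
(`MatsubaraIdx M`, BGM 2006 §2.1, Salmhofer 1999 (4.63)).  For `M ≤ M″` the kept set at `M` is a WINDOW of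
the kept set at `M″`; the complement is the ultraviolet SHELL `M ≤ n < M″`, `-M″ ≤ n < -M`.  This file
records the purely algebraic facts which make the two theories comparable EXACTLY, for every value of the
coupling (nothing is expanded, nothing is bounded):

* §1 the label embeddings `MatsubaraIdx.emb`, `FreqMomentum.emb`, `HubbardFieldIdx.emb` (`n ↦ n`: the
  integer label, the frequency, the reflection `rev`/`neg` and the momentum are preserved; the window is
  reflection-stable);
* §2 the two algebra homomorphisms between `HubbardGrassmann L M` and `HubbardGrassmann L M″`: the
  RESTRICTION `cutoffRestrict` (`ψ̂_{X″} ↦ ψ̂_X` on the window, `↦ 0` on the shell; Mathlib's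
  `ExteriorAlgebra.map (LinearMap.funLeft ℂ ℂ emb)`) and the EXTENSION `cutoffExtend` (`ψ̂_X ↦ ψ̂_{emb X}`;
  `ExteriorAlgebra.map (Matrix.toLin' Eᵀ)` with the window matrix `E X X″ = [emb X = X″]`), with
  `cutoffRestrict ∘ cutoffExtend = id`;
* part II (`HubbardMatsubaraCutoffBlocks.lean`): the interaction restricts exactly,
  `cutoffRestrict (hubbardInteractionCT L M″ β U K) = hubbardInteractionCT L M β U K` (integer frequency
  conservation of the quartic vertex), and the covariances are block diagonal,
  `C″^K_{>Λ} = Eᵀ C^K_{>Λ} E + S` with the SHELL COVARIANCE `S` supported on shell × shell;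
* part III (`HubbardMatsubaraCutoffEffAction.lean`): the consequences for the effective actions
  (`π 𝒢″_Λ = effAction C_{>Λ} (π (effAction S V″))` by the tree's `effAction_map`/`effAction_add`), kernels
  and self-energies at window labels, shell-free infrared slices.

Everything is proved; no named fact.

## Sources

G. Benfatto, A. Giuliani, V. Mastropietro, Ann. Henri Poincaré 7 (2006) 809, §2.1 (2.1)–(2.6) (the
ultraviolet cutoff `M` on `k₀` and the limit `M → ∞`) [`BenfattoGiulianiMastropietro2006`]; M. Salmhofer,
*Renormalization* (1999), §4.2.4 (4.63)–(4.65) [`Salmhofer1999`]; F. A. Berezin, *The Method of Second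
Quantization* (1966), Ch. I §3 (homomorphisms of Grassmann algebras induced by maps of generators)
[`Berezin1966`].  All statements are routine bookkeeping; the `[cite: …]` tags LOCATE the construct each lemma is about
(Salmhofer's frequency set (4.63) for the labels, Berezin's induced homomorphisms for `π`, `ι`) — none of them is a
named theorem of those sources.

## Design

`M ≤ M″` is a hypothesis `(h : M ≤ M″)` of the embeddings (the index shift is `M″ - M`).  The homomorphisms
are written with Mathlib's `ExteriorAlgebra.map`, so that `GrassmannLinearSubstitution.effAction_map` /
`kernel_map` apply verbatim; `windowMatrix` is the `0/1` matrix of `LinearMap.funLeft ℂ ℂ emb`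
(`toMatrix'_funLeft_emb`).  Finite `(β, L, M, M″)`, any `U, μ, h, K, Λ`.
-/

noncomputable section

namespace Literature.MathematicalPhysics.QuantumLattice

open GrassmannAlgebra Finset

/-! ### §1 The label embeddings -/

namespace MatsubaraIdx

variable {M M'' : ℕ}

/-- **The window embedding of Matsubara labels**: the label of the integer `n` at cutoff `M`
(`i = n + M`) goes to the label of the same integer at cutoff `M″ ≥ M` (`n + M″`). [cite: Salmhofer1999, §4.2.4 (4.63)] -/
def emb (h : M ≤ M'') (i : MatsubaraIdx M) : MatsubaraIdx M'' :=
  ⟨(i : ℕ) + (M'' - M), by have := i.isLt; omega⟩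

/-- The underlying natural number of the embedded label. [cite: Salmhofer1999, §4.2.4 (4.63)] -/
@[simp] theorem coe_emb (h : M ≤ M'') (i : MatsubaraIdx M) : ((emb h i : MatsubaraIdx M'') : ℕ) = i + (M'' - M) := rfl

/-- The window embedding is injective. [cite: Salmhofer1999, §4.2.4 (4.63)] -/
theorem emb_injective (h : M ≤ M'') : Function.Injective (emb h : MatsubaraIdx M → MatsubaraIdx M'') := by
  intro i j hij
  have := congrArg (fun x : MatsubaraIdx M'' => (x : ℕ)) hij
  simp only [coe_emb] at this
  exact Fin.ext (by omega)

/-- The embedding commutes with the frequency reflection `rev` (`n ↦ -n-1`): the window is symmetric.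
[cite: Salmhofer1999, §4.2.4 (4.63)] -/
theorem emb_rev (h : M ≤ M'') (i : MatsubaraIdx M) : emb h i.rev = (emb h i).rev := by
  apply Fin.ext
  have := i.isLt
  simp only [coe_emb, Fin.val_rev]
  omega

/-- A label of cutoff `M″` is in the window iff its integer lies in `[-M, M)`. [cite: Salmhofer1999, §4.2.4 (4.63)] -/
theorem mem_range_emb_iff (h : M ≤ M'') (j : MatsubaraIdx M'') :
    j ∈ Set.range (emb h) ↔ -(M : ℤ) ≤ matsubaraInt M'' j ∧ matsubaraInt M'' j < M := by
  constructor
  · rintro ⟨i, rfl⟩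
    have := i.isLt
    simp only [matsubaraInt, coe_emb]
    push_cast
    omega
  · rintro ⟨h1, h2⟩
    have hj := j.isLt
    simp only [matsubaraInt] at h1 h2
    refine ⟨⟨(j : ℕ) - (M'' - M), by omega⟩, Fin.ext ?_⟩
    simp only [coe_emb]
    omega

/-- Off the window the integer label satisfies `M ≤ n` or `n < -M`. [cite: Salmhofer1999, §4.2.4 (4.63)] -/
theorem le_or_lt_of_not_mem_range_emb (h : M ≤ M'') {j : MatsubaraIdx M''} (hj : j ∉ Set.range (emb h)) :
    (M : ℤ) ≤ matsubaraInt M'' j ∨ matsubaraInt M'' j < -(M : ℤ) := by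
  rw [mem_range_emb_iff] at hj
  omega

end MatsubaraIdx

section Labels

variable {M M'' : ℕ}

/-- **The integer label is preserved**: `n(emb i) = n(i)`. [cite: Salmhofer1999, §4.2.4 (4.63)] -/
@[simp] theorem matsubaraInt_emb (h : M ≤ M'') (i : MatsubaraIdx M) :
    matsubaraInt M'' (MatsubaraIdx.emb h i) = matsubaraInt M i := by
  simp only [matsubaraInt, MatsubaraIdx.coe_emb]
  push_cast
  omega

/-- **The frequency is preserved**: `ω(emb i) = ω(i)`. [cite: Salmhofer1999, §4.2.4 (4.63)] -/
@[simp] theorem matsubaraFreq_emb (h : M ≤ M'') (β : ℝ) (i : MatsubaraIdx M) :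
    matsubaraFreq β M'' (MatsubaraIdx.emb h i) = matsubaraFreq β M i := by
  simp only [matsubaraFreq, matsubaraInt_emb]

/-- **Off the window the frequencies are large**: `|ω| ≥ π(2M+1)/β` on the shell (`0 < β`). [cite: Salmhofer1999, §4.2.4 (4.63)] -/
theorem le_abs_matsubaraFreq_of_not_mem_range {β : ℝ} (hβ : 0 < β) (h : M ≤ M'') {j : MatsubaraIdx M''}
    (hj : j ∉ Set.range (MatsubaraIdx.emb h)) :
    Real.pi * (2 * M + 1) / β ≤ |matsubaraFreq β M'' j| := by
  rw [matsubaraFreq, abs_div, abs_mul, abs_of_pos Real.pi_pos, abs_of_pos hβ]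
  refine div_le_div_of_nonneg_right (mul_le_mul_of_nonneg_left ?_ Real.pi_pos.le) hβ.le
  rcases MatsubaraIdx.le_or_lt_of_not_mem_range_emb h hj with hle | hlt
  · have : (M : ℝ) ≤ matsubaraInt M'' j := by exact_mod_cast hle
    rw [abs_of_nonneg (by linarith)]
    linarith
  · have hlt' : matsubaraInt M'' j ≤ -(M : ℤ) - 1 := by omega
    have : (matsubaraInt M'' j : ℝ) ≤ -(M : ℝ) - 1 := by exact_mod_cast hlt'
    rw [abs_of_neg (by linarith)]
    linarith

variable {L : ℕ}

/-- The window embedding of frequency–momentum labels (momentum unchanged). [cite: Salmhofer1999, §4.2.4 (4.63)] -/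
def FreqMomentum.emb (h : M ≤ M'') (k : FreqMomentum L M) : FreqMomentum L M'' := (MatsubaraIdx.emb h k.1, k.2)

/-- Components of the embedded label. [cite: Salmhofer1999, §4.2.4 (4.63)] -/
@[simp] theorem FreqMomentum.emb_fst (h : M ≤ M'') (k : FreqMomentum L M) : (FreqMomentum.emb h k).1 = MatsubaraIdx.emb h k.1 := rfl

/-- Components of the embedded label. [cite: Salmhofer1999, §4.2.4 (4.63)] -/
@[simp] theorem FreqMomentum.emb_snd (h : M ≤ M'') (k : FreqMomentum L M) : (FreqMomentum.emb h k).2 = k.2 := rfl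

/-- The embedding of frequency–momentum labels is injective. [cite: Salmhofer1999, §4.2.4 (4.63)] -/
theorem FreqMomentum.emb_injective (h : M ≤ M'') : Function.Injective (FreqMomentum.emb (L := L) h) := by
  intro k k' hk
  have h1 := congrArg Prod.fst hk
  have h2 := congrArg Prod.snd hk
  simp only [FreqMomentum.emb_fst, FreqMomentum.emb_snd] at h1 h2
  exact Prod.ext (MatsubaraIdx.emb_injective h h1) h2

/-- The embedding commutes with `k ↦ -k`. [cite: Salmhofer1999, §4.2.4 (4.63)] -/
theorem FreqMomentum.emb_neg (h : M ≤ M'') (k : FreqMomentum L M) : FreqMomentum.emb h k.neg = (FreqMomentum.emb h k).neg := by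
  simp only [FreqMomentum.emb, FreqMomentum.neg, MatsubaraIdx.emb_rev]

/-- The window of frequency–momentum labels is stable under `k ↦ -k`. [cite: Salmhofer1999, §4.2.4 (4.63)] -/
theorem FreqMomentum.neg_mem_range_emb_iff (h : M ≤ M'') (k : FreqMomentum L M'') :
    k.neg ∈ Set.range (FreqMomentum.emb (L := L) h) ↔ k ∈ Set.range (FreqMomentum.emb (L := L) h) := by
  constructor
  · rintro ⟨k', hk'⟩
    refine ⟨k'.neg, ?_⟩
    rw [FreqMomentum.emb_neg, hk', FreqMomentum.neg_neg]
  · rintro ⟨k', rfl⟩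
    exact ⟨k'.neg, FreqMomentum.emb_neg h k'⟩

/-- A frequency–momentum label is in the window iff its frequency label is. [cite: Salmhofer1999, §4.2.4 (4.63)] -/
theorem FreqMomentum.mem_range_emb_iff (h : M ≤ M'') (k : FreqMomentum L M'') :
    k ∈ Set.range (FreqMomentum.emb (L := L) h) ↔ k.1 ∈ Set.range (MatsubaraIdx.emb h) := by
  constructor
  · rintro ⟨k', rfl⟩; exact ⟨k'.1, rfl⟩
  · rintro ⟨i, hi⟩; exact ⟨(i, k.2), Prod.ext hi rfl⟩

/-- The window embedding of field labels `((k, σ), c) ↦ ((emb k, σ), c)`. [cite: Salmhofer1999, §4.2.4 (4.63)] -/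
def HubbardFieldIdx.emb (h : M ≤ M'') (X : HubbardFieldIdx L M) : HubbardFieldIdx L M'' :=
  ((FreqMomentum.emb h X.1.1, X.1.2), X.2)

/-- Components of the embedded field label. [cite: Salmhofer1999, §4.2.4 (4.63)] -/
@[simp] theorem HubbardFieldIdx.emb_fst_fst (h : M ≤ M'') (X : HubbardFieldIdx L M) :
    (HubbardFieldIdx.emb h X).1.1 = FreqMomentum.emb h X.1.1 := rfl

/-- Components of the embedded field label. [cite: Salmhofer1999, §4.2.4 (4.63)] -/
@[simp] theorem HubbardFieldIdx.emb_fst_snd (h : M ≤ M'') (X : HubbardFieldIdx L M) :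
    (HubbardFieldIdx.emb h X).1.2 = X.1.2 := rfl

/-- Components of the embedded field label. [cite: Salmhofer1999, §4.2.4 (4.63)] -/
@[simp] theorem HubbardFieldIdx.emb_snd (h : M ≤ M'') (X : HubbardFieldIdx L M) :
    (HubbardFieldIdx.emb h X).2 = X.2 := rfl

/-- The embedding of field labels is injective. [cite: Salmhofer1999, §4.2.4 (4.63)] -/
theorem HubbardFieldIdx.emb_injective (h : M ≤ M'') : Function.Injective (HubbardFieldIdx.emb (L := L) h) := by
  intro X Y hXY
  have h1 := congrArg (fun Z : HubbardFieldIdx L M'' => Z.1.1) hXY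
  have h2 := congrArg (fun Z : HubbardFieldIdx L M'' => Z.1.2) hXY
  have h3 := congrArg (fun Z : HubbardFieldIdx L M'' => Z.2) hXY
  simp only [HubbardFieldIdx.emb_fst_fst, HubbardFieldIdx.emb_fst_snd, HubbardFieldIdx.emb_snd] at h1 h2 h3
  exact Prod.ext (Prod.ext (FreqMomentum.emb_injective h h1) h2) h3

/-- The momentum label of an embedded field is the embedded momentum label. [cite: Salmhofer1999, §4.2.4 (4.63)] -/
@[simp] theorem momentumOf_emb (h : M ≤ M'') (X : HubbardFieldIdx L M) :
    momentumOf L M'' (HubbardFieldIdx.emb h X) = FreqMomentum.emb h (momentumOf L M X) := rfl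

/-- A field label is in the window iff its frequency–momentum label is. [cite: Salmhofer1999, §4.2.4 (4.63)] -/
theorem HubbardFieldIdx.mem_range_emb_iff (h : M ≤ M'') (X : HubbardFieldIdx L M'') :
    X ∈ Set.range (HubbardFieldIdx.emb (L := L) h) ↔ momentumOf L M'' X ∈ Set.range (FreqMomentum.emb (L := L) h) := by
  constructor
  · rintro ⟨Y, rfl⟩; exact ⟨momentumOf L M Y, rfl⟩
  · rintro ⟨k, hk⟩
    refine ⟨((k, X.1.2), X.2), ?_⟩
    obtain ⟨⟨k'', σ⟩, c⟩ := X
    simp only [momentumOf] at hk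
    simp only [HubbardFieldIdx.emb, hk]

/-- **The Nambu relabelling commutes with the embedding** (it only reflects `k` for spin `↓`). [cite: Salmhofer1999, §4.2.4 (4.63)] -/
theorem toNambu_emb (h : M ≤ M'') (X : HubbardFieldIdx L M) :
    toNambu (HubbardFieldIdx.emb h X) = HubbardFieldIdx.emb h (toNambu X) := by
  obtain ⟨⟨k, σ⟩, c⟩ := X
  by_cases hσ : σ = 0
  · simp [toNambu, HubbardFieldIdx.emb, hσ]
  · simp [toNambu, HubbardFieldIdx.emb, hσ, FreqMomentum.emb_neg]

end Labels

/-! ### §2 The restriction and extension homomorphisms -/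

section Restrict

variable (L : ℕ) {M M'' : ℕ}

/-- **The window matrix** `E X X″ = [emb X = X″]` (rows: labels at cutoff `M`; columns: labels at cutoff
`M″`) — the matrix of the substitution `LinearMap.funLeft ℂ ℂ emb` (`toMatrix'_funLeft_emb`). [cite: Berezin1966, Ch. I §3] -/
def windowMatrix (h : M ≤ M'') : Matrix (HubbardFieldIdx L M) (HubbardFieldIdx L M'') ℂ :=
  Matrix.of fun X X'' => if HubbardFieldIdx.emb h X = X'' then 1 else 0

/-- **The cutoff restriction** `π : HubbardGrassmann L M″ → HubbardGrassmann L M`: the algebra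
homomorphism `ψ̂_{emb X} ↦ ψ̂_X`, `ψ̂_{X″} ↦ 0` for `X″` on the shell (setting the shell fields to zero).
[cite: Berezin1966, Ch. I §3] -/
def cutoffRestrict (h : M ≤ M'') : HubbardGrassmann L M'' →ₐ[ℂ] HubbardGrassmann L M :=
  ExteriorAlgebra.map (LinearMap.funLeft ℂ ℂ (HubbardFieldIdx.emb (L := L) h))

variable {L}

/-- Entries of the window matrix. [cite: Berezin1966, Ch. I §3] -/
theorem windowMatrix_apply (h : M ≤ M'') (X : HubbardFieldIdx L M) (X'' : HubbardFieldIdx L M'') :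
    windowMatrix L h X X'' = if HubbardFieldIdx.emb h X = X'' then 1 else 0 := rfl

/-- The window matrix at an embedded column: `E X (emb Y) = [X = Y]`. [cite: Berezin1966, Ch. I §3] -/
theorem windowMatrix_apply_emb (h : M ≤ M'') (X Y : HubbardFieldIdx L M) :
    windowMatrix L h X (HubbardFieldIdx.emb h Y) = if X = Y then 1 else 0 := by
  simp only [windowMatrix_apply, (HubbardFieldIdx.emb_injective h).eq_iff]

/-- The window matrix vanishes at shell columns. [cite: Berezin1966, Ch. I §3] -/
theorem windowMatrix_apply_of_not_mem (h : M ≤ M'') (X : HubbardFieldIdx L M) {X'' : HubbardFieldIdx L M''}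
    (hX'' : X'' ∉ Set.range (HubbardFieldIdx.emb (L := L) h)) : windowMatrix L h X X'' = 0 := by
  rw [windowMatrix_apply, if_neg]
  rintro rfl
  exact hX'' ⟨X, rfl⟩

/-- The restriction substitution on basis vectors: window. [cite: Berezin1966, Ch. I §3] -/
theorem funLeft_emb_single_emb (h : M ≤ M'') (X : HubbardFieldIdx L M) (r : ℂ) :
    LinearMap.funLeft ℂ ℂ (HubbardFieldIdx.emb (L := L) h) (Pi.single (HubbardFieldIdx.emb h X) r) = Pi.single X r := by
  ext Y
  simp only [LinearMap.funLeft_apply, Pi.single_apply, (HubbardFieldIdx.emb_injective h).eq_iff]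

/-- The restriction substitution on basis vectors: shell. [cite: Berezin1966, Ch. I §3] -/
theorem funLeft_emb_single_of_not_mem (h : M ≤ M'') {X'' : HubbardFieldIdx L M''}
    (hX'' : X'' ∉ Set.range (HubbardFieldIdx.emb (L := L) h)) (r : ℂ) :
    LinearMap.funLeft ℂ ℂ (HubbardFieldIdx.emb (L := L) h) (Pi.single X'' r) = 0 := by
  ext Y
  simp only [LinearMap.funLeft_apply, Pi.single_apply, Pi.zero_apply]
  rw [if_neg]
  rintro hY
  exact hX'' ⟨Y, hY⟩

/-- **`π` on a window generator**: `π ψ̂_{emb X} = ψ̂_X`. [cite: Berezin1966, Ch. I §3] -/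
theorem cutoffRestrict_gen_emb (h : M ≤ M'') (X : HubbardFieldIdx L M) :
    cutoffRestrict L h (gen ℂ (HubbardFieldIdx.emb h X)) = gen ℂ X := by
  rw [cutoffRestrict, gen, ExteriorAlgebra.map_apply_ι, funLeft_emb_single_emb, gen]

/-- **`π` on a shell generator**: `π ψ̂_{X″} = 0`. [cite: Berezin1966, Ch. I §3] -/
theorem cutoffRestrict_gen_of_not_mem (h : M ≤ M'') {X'' : HubbardFieldIdx L M''}
    (hX'' : X'' ∉ Set.range (HubbardFieldIdx.emb (L := L) h)) : cutoffRestrict L h (gen ℂ X'') = 0 := by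
  rw [cutoffRestrict, gen, ExteriorAlgebra.map_apply_ι, funLeft_emb_single_of_not_mem h hX'', map_zero]

/-- `π` on the field `ψ̂⁺` of a window label. [cite: Berezin1966, Ch. I §3] -/
theorem cutoffRestrict_psiPlus_emb (h : M ≤ M'') (k : FreqMomentum L M) (σ : Fin 2) :
    cutoffRestrict L h (psiPlus (FreqMomentum.emb h k) σ) = psiPlus k σ :=
  cutoffRestrict_gen_emb h ((k, σ), 0)

/-- `π` on the field `ψ̂⁻` of a window label. [cite: Berezin1966, Ch. I §3] -/
theorem cutoffRestrict_psiMinus_emb (h : M ≤ M'') (k : FreqMomentum L M) (σ : Fin 2) :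
    cutoffRestrict L h (psiMinus (FreqMomentum.emb h k) σ) = psiMinus k σ :=
  cutoffRestrict_gen_emb h ((k, σ), 1)

/-- `π` kills the field `ψ̂⁺` of a shell label. [cite: Berezin1966, Ch. I §3] -/
theorem cutoffRestrict_psiPlus_of_not_mem (h : M ≤ M'') {k : FreqMomentum L M''}
    (hk : k ∉ Set.range (FreqMomentum.emb (L := L) h)) (σ : Fin 2) : cutoffRestrict L h (psiPlus k σ) = 0 :=
  cutoffRestrict_gen_of_not_mem h (X'' := ((k, σ), 0)) (by rwa [HubbardFieldIdx.mem_range_emb_iff])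

/-- `π` kills the field `ψ̂⁻` of a shell label. [cite: Berezin1966, Ch. I §3] -/
theorem cutoffRestrict_psiMinus_of_not_mem (h : M ≤ M'') {k : FreqMomentum L M''}
    (hk : k ∉ Set.range (FreqMomentum.emb (L := L) h)) (σ : Fin 2) : cutoffRestrict L h (psiMinus k σ) = 0 :=
  cutoffRestrict_gen_of_not_mem h (X'' := ((k, σ), 1)) (by rwa [HubbardFieldIdx.mem_range_emb_iff])

end Restrict

section Extend

variable (L : ℕ) [NeZero L] {M M'' : ℕ}

/-- **The cutoff extension** `ι : HubbardGrassmann L M → HubbardGrassmann L M″`: the algebra homomorphism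
`ψ̂_X ↦ ψ̂_{emb X}` (the theory at cutoff `M` read inside the larger algebra). [cite: Berezin1966, Ch. I §3] -/
def cutoffExtend (h : M ≤ M'') : HubbardGrassmann L M →ₐ[ℂ] HubbardGrassmann L M'' :=
  ExteriorAlgebra.map (Matrix.toLin' (windowMatrix L h).transpose)

variable {L}

/-- **The window matrix is the matrix of the restriction substitution** `v ↦ v ∘ emb`. [cite: Berezin1966, Ch. I §3] -/
theorem toMatrix'_funLeft_emb (h : M ≤ M'') :
    LinearMap.toMatrix' (LinearMap.funLeft ℂ ℂ (HubbardFieldIdx.emb (L := L) h)) = windowMatrix L h := by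
  ext X X''
  rw [LinearMap.toMatrix'_apply, LinearMap.funLeft_apply, windowMatrix_apply, Pi.single_apply]

/-- The matrix of the extension substitution is `Eᵀ`. [cite: Berezin1966, Ch. I §3] -/
theorem toMatrix'_toLin'_windowMatrix_transpose (h : M ≤ M'') :
    LinearMap.toMatrix' (Matrix.toLin' (windowMatrix L h).transpose) = (windowMatrix L h).transpose :=
  LinearMap.toMatrix'_toLin' _

/-- The extension substitution on basis vectors. [cite: Berezin1966, Ch. I §3] -/
theorem toLin'_windowMatrix_transpose_single (h : M ≤ M'') (X : HubbardFieldIdx L M) (r : ℂ) :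
    Matrix.toLin' (windowMatrix L h).transpose (Pi.single X r) = Pi.single (HubbardFieldIdx.emb h X) r := by
  ext X''
  simp only [Matrix.toLin'_apply, Matrix.mulVec, dotProduct_single, Matrix.transpose_apply, windowMatrix_apply,
    Pi.single_apply, boole_mul]
  by_cases hX : HubbardFieldIdx.emb h X = X''
  · rw [if_pos hX, if_pos hX.symm]
  · rw [if_neg hX, if_neg (Ne.symm hX)]

/-- **`ι` on a generator**: `ι ψ̂_X = ψ̂_{emb X}`. [cite: Berezin1966, Ch. I §3] -/
theorem cutoffExtend_gen (h : M ≤ M'') (X : HubbardFieldIdx L M) :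
    cutoffExtend L h (gen ℂ X) = gen ℂ (HubbardFieldIdx.emb h X) := by
  rw [cutoffExtend, gen, ExteriorAlgebra.map_apply_ι, toLin'_windowMatrix_transpose_single, gen]

/-- Restricting after extending is the identity on the generator space. [cite: Berezin1966, Ch. I §3] -/
theorem funLeft_emb_comp_toLin' (h : M ≤ M'') :
    LinearMap.funLeft ℂ ℂ (HubbardFieldIdx.emb (L := L) h) ∘ₗ Matrix.toLin' (windowMatrix L h).transpose = LinearMap.id := by
  refine LinearMap.pi_ext' fun X => LinearMap.ext_ring ?_
  rw [LinearMap.comp_apply, LinearMap.comp_apply, LinearMap.id_comp, LinearMap.coe_single,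
    toLin'_windowMatrix_transpose_single, funLeft_emb_single_emb]

/-- **`π ∘ ι = id`**: the theory at cutoff `M`, extended and restricted, is itself. [cite: Berezin1966, Ch. I §3] -/
theorem cutoffRestrict_cutoffExtend (h : M ≤ M'') (a : HubbardGrassmann L M) :
    cutoffRestrict L h (cutoffExtend L h a) = a := by
  rw [cutoffRestrict, cutoffExtend, ← AlgHom.comp_apply, ExteriorAlgebra.map_comp_map, funLeft_emb_comp_toLin',
    ExteriorAlgebra.map_id, AlgHom.id_apply]

/-- `ι` on the fields `ψ̂^±`. [cite: Berezin1966, Ch. I §3] -/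
theorem cutoffExtend_psiPlus (h : M ≤ M'') (k : FreqMomentum L M) (σ : Fin 2) :
    cutoffExtend L h (psiPlus k σ) = psiPlus (FreqMomentum.emb h k) σ :=
  cutoffExtend_gen h ((k, σ), 0)

/-- `ι` on the fields `ψ̂^±`. [cite: Berezin1966, Ch. I §3] -/
theorem cutoffExtend_psiMinus (h : M ≤ M'') (k : FreqMomentum L M) (σ : Fin 2) :
    cutoffExtend L h (psiMinus k σ) = psiMinus (FreqMomentum.emb h k) σ :=
  cutoffExtend_gen h ((k, σ), 1)

end Extend

end Literature.MathematicalPhysics.QuantumLattice
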